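import Literature.AlgebraicGeometry.Resolution.Kuhlmann2019HenselianRationalitySteps
import Literature.AlgebraicGeometry.Resolution.FiniteRankOverPrimeField
import Mathlib.RingTheory.AlgebraicIndependent.TranscendenceBasis
import Mathlib.FieldTheory.SeparableClosure
import HarnessLib

/-!
# Kuhlmann 2016, Cor. 3.8 / Cor. 3.16 (fields of definition of finite rank) — PROVED

Topic: `Literature/AlgebraicGeometry/Resolution` (valued function fields). We PROVE the named
fact `Kuhlmann2016_Cor38` of `Kuhlmann2019HenselianRationalitySteps.lean`
(`Kuhlmann2016_Cor38_holds`), the first ingredient of the proof of Kuhlmann 2019, Prop. 5.7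
(`Kuhlmann2019_Thm13_sepClosed.of_prop56`, `Kuhlmann2019HenselianRationalityProofs.lean`):

> F.-V. Kuhlmann, *The algebra and model theory of tame valued fields*, J. reine angew. Math.
> 719 (2016) 1–43 = arXiv:1304.0194, **Corollary 3.8.** For every valued function field `F`
> with given transcendence basis `𝒯` over a tame field `K`, there exists a tame subfield `K₀`
> of `K` of finite rank with `K₀v = Kv` and `vK/vK₀` torsion free, and a function field `F₀`
> with transcendence basis `𝒯` over `K₀` such that `F = K.F₀` and `[F₀:K₀(𝒯)] = [F:K(𝒯)]`.
> *Proof.* Let `F = K(𝒯)(a₁,…,aₙ)`. There exists a finitely generated subfield `K₁` of `K`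
> such that `a₁,…,aₙ` are algebraic over `K₁(𝒯)` … This will still hold if we replace `K₁` by
> any extension field of `K₁` within `K`. As a finitely generated field, `(K₁,v)` has finite
> rank. Now let `y_j`, `j ∈ J`, be a system of elements in `K` such that the residues `y_j v`,
> `j ∈ J`, form a transcendence basis of `Kv` over `K₁v`. According to Lemma 2.2, the field
> `K₁(y_j | j ∈ J)` has residue field `K₁v(y_j v | j ∈ J)` and the same value group as `K₁`,
> hence it is again a field of finite rank. Let `K₀` be the relative algebraic closure of this
> field within `K`. Since by construction, `Kv|K₁v(y_jv | j ∈ J)` and thus also `Kv|K₀v` are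
> algebraic … As an algebraic extension of a field of finite rank, it is itself of finite
> rank. Finally, the function field `F₀ = K₀(𝒯)(a₁,…,aₙ)` has transcendence basis `𝒯` over
> `K₀` and satisfies equations (13) and (14).
>
> **Corollary 3.16.** Corollary 3.8 also holds for separably tame fields in place of tame
> fields. More precisely, if `F|K` is a separable extension, then `F₀` and `K₀` can be chosen
> such that `F₀|K₀` is a separable extension. Moreover, if `vK` is cofinal in `vF` then it can
> also be assumed that `vK₀` is cofinal in `vF₀`. *Proof.* … The first additional assertion
> can be shown using the fact that the finitely generated separable extension `F|K` is
> separably generated. The second additional assertion is seen as follows. If `vF` admits a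
> biggest proper convex subgroup, then let `K₀` contain a nonzero element whose value does not
> lie in this subgroup. If `vF` and thus also `vK` does not admit a biggest proper convex
> subgroup, then first choose `F₀` and `K₀` as in the (generalized) proof of Corollary 3.8;
> since `F₀` has finite rank, there exists some element in `K` whose value does not lie in the
> convex hull of `vF₀` in `vF`, and adding this element to `K₀` and `F₀` will make `vK₀`
> cofinal in `vF₀`.

The vendored fact records exactly this CONSTRUCTION for `𝒯 = {t}` over an arbitrary valued
base field (module docstring of the Steps file); the tame conclusions are not part of it.

## The proof

Everything happens inside one valued field `(Ω, V)`; `ℙ = ⊥` is the prime subfield.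

* **Finite rank** (`hasFiniteRank_of_isAlgebraic_closure`). "Finite rank" is rendered as
  `HasFiniteRank V M`: finitely many overrings of `V ∩ M` in the field `M`. Instead of
  transporting ranks along "same value group" and "algebraic extension", we run Kuhlmann 2010,
  Cor. 2.7 in the relative form already in the tree (`finite_overrings_of_subfield`,
  `FiniteRankOverPrimeField.lean`: finitely many overrings as soon as some subfield `K'` of
  finite transcendence codegree is met by the overrings in at most two ways) with
  `K' = ℙ(y_j | j ∈ J)`: by Lemma 2.2 = Knaf–Kuhlmann 2005, Thm. 2.1
  (`exists_valuation_eq_of_mem_closure`, `ValuationIndependence.lean`) every value of `K'` is a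
  value of `ℙ` (`exists_valuation_eq_bot_of_mem_closure`), so an overring of `V ∩ M` either
  contains `K'` or agrees with `V` on it (`bot_subset_of_mem_of_not_mem`); and `K₀`, `F₀` are
  algebraic over `K'(A)`, `K'(A, t)` for the finite set `A` generating `K₁`.
* **Residue transcendence basis** (`exists_residue_transcendence_family`): Mathlib's
  `exists_isTranscendenceBasis` for `Kv|K₁v`, lifted along the residue map.
* **The data `A`** (`exists_finset_isAlgebraic_adjoin`, `exists_finset_isSeparable_adjoin`,
  `exists_finset_mem_adjoin`): the coefficients of the minimal polynomials of the generators
  over `K(t)` (resp. over `K(T)` for a separating transcendence basis `T`, and the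
  coefficients expressing `T` in the generators) lie in `C(t)` for a finite `C ⊆ K`, and the
  polynomials descend (`isAlgebraic_of_coeff_mem`, `isSeparable_of_coeff_mem`).
* **Cofinality.** Case 1 of the source ("biggest proper convex subgroup") is rendered as: some
  `b ∈ K` has `ℤ v(b)` cofinal in `vF`; then `b ∈ K₀` suffices. Case 2: `F₀` has finite rank,
  hence an element `a₀` whose value generates `vF₀` as a convex subgroup
  (`exists_dominating_of_hasFiniteRank`: otherwise the valuation rings of the coarsenings by
  the convex subgroups generated by single values give an infinite chain of overrings); by the negation of Case 1 and the cofinality of `vK` in `vF`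
  there is `b ∈ K` with `v(b)` below the convex hull of `vF₀`; the fields `K₀' ⊇ K₀(b)`,
  `F₀' = F₀.K₀'` of the construction run with `A ∪ {b}` are algebraic over `F₀(b)`, whose value
  group is `vF₀ ⊕ ℤv(b)` ordered with `v(b) ≪ vF₀` (`exists_valuation_eq_of_infinitesimal`,
  again Knaf–Kuhlmann 2005, Thm. 2.1), and algebraic extensions do not destroy cofinality
  (`exists_valuation_le_of_isAlgebraic`).

## Main results (all PROVED; axioms `propext`, `Classical.choice`, `Quot.sound`)

* `hasFiniteRank_of_isAlgebraic_closure`, `exists_dominating_of_hasFiniteRank`,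
  `exists_residue_transcendence_family`, `exists_valuation_eq_of_infinitesimal`.
* `cor38_construction`, `cor38_of_data` — the construction for given finite data.
* `Kuhlmann2016_Cor38_holds : Kuhlmann2016_Cor38`.

## Sources

* F.-V. Kuhlmann, J. reine angew. Math. 719 (2016) 1–43 = arXiv:1304.0194: Lemma 2.2 (p. 6),
  Cor. 3.8 with proof (pp. 10–11), Cor. 3.16 with proof (p. 12). [cite: Kuhlmann2016, Cor. 3.8]
* F.-V. Kuhlmann, Trans. AMS 362 (2010) = arXiv:1003.5678, Cor. 2.7 (finite rank).
* H. Knaf, F.-V. Kuhlmann, Ann. Sci. ÉNS 38 (2005), Thm. 2.1 (valuation independence).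
-/

noncomputable section

open IsLocalRing Polynomial

namespace Literature.AlgebraicGeometry.Resolution

universe u

variable {Ω : Type u} [Field Ω]

/-! ### Field-theoretic finiteness and descent lemmas -/

section FieldLemmas

/-- An element of the subfield generated by `A ∪ T` already lies in the subfield generated by
`C ∪ T` for a finite `C ⊆ A`. [folklore] -/
theorem exists_finset_mem_closure_union {A T : Set Ω} {x : Ω}
    (hx : x ∈ Subfield.closure (A ∪ T)) :
    ∃ C : Finset Ω, (↑C : Set Ω) ⊆ A ∧ x ∈ Subfield.closure (↑C ∪ T) := by
  classical
  induction hx using Subfield.closure_induction with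
  | mem a h =>
    rcases h with ha | ha
    · refine ⟨{a}, by simpa using ha, Subfield.subset_closure (Or.inl ?_)⟩
      simp
    · exact ⟨∅, by simp, Subfield.subset_closure (Or.inr ha)⟩
  | one => exact ⟨∅, by simp, one_mem _⟩
  | add a b _ _ ha hb =>
    obtain ⟨C, hC, haC⟩ := ha
    obtain ⟨D, hD, hbD⟩ := hb
    refine ⟨C ∪ D, ?_, add_mem ?_ ?_⟩
    · rw [Finset.coe_union]; exact Set.union_subset hC hD
    · exact Subfield.closure_mono (Set.union_subset_union_left _ (by simp)) haC
    · exact Subfield.closure_mono (Set.union_subset_union_left _ (by simp)) hbD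
  | neg a _ ha =>
    obtain ⟨C, hC, haC⟩ := ha
    exact ⟨C, hC, neg_mem haC⟩
  | inv a _ ha =>
    obtain ⟨C, hC, haC⟩ := ha
    exact ⟨C, hC, inv_mem haC⟩
  | mul a b _ _ ha hb =>
    obtain ⟨C, hC, haC⟩ := ha
    obtain ⟨D, hD, hbD⟩ := hb
    refine ⟨C ∪ D, ?_, mul_mem ?_ ?_⟩
    · rw [Finset.coe_union]; exact Set.union_subset hC hD
    · exact Subfield.closure_mono (Set.union_subset_union_left _ (by simp)) haC
    · exact Subfield.closure_mono (Set.union_subset_union_left _ (by simp)) hbD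

/-- A polynomial over a subfield `E` all of whose coefficients lie in a subfield `E'` comes
from a polynomial over `E'` (same image in `Ω[X]`). [folklore] -/
theorem exists_map_eq_map_of_coeff_mem {E E' : Subfield Ω} (p : E[X])
    (h : ∀ n, ((p.coeff n : E) : Ω) ∈ E') :
    ∃ q : E'[X], q.map E'.subtype = p.map E.subtype := by
  have hl : p.map E.subtype ∈ Polynomial.lifts E'.subtype := by
    rw [Polynomial.lifts_iff_coeff_lifts]
    intro n
    rw [Polynomial.coeff_map]
    exact ⟨⟨_, h n⟩, rfl⟩
  exact (Polynomial.mem_lifts _).mp hl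

/-- Descent of algebraicity: a root of a non-zero polynomial over `E` whose coefficients lie in
`E'` is algebraic over `E'`. [folklore] -/
theorem isAlgebraic_of_coeff_mem {E E' : Subfield Ω} {x : Ω} {p : E[X]} (hp0 : p ≠ 0)
    (hpx : Polynomial.aeval x p = 0) (h : ∀ n, ((p.coeff n : E) : Ω) ∈ E') :
    IsAlgebraic E' x := by
  obtain ⟨q, hq⟩ := exists_map_eq_map_of_coeff_mem p h
  refine ⟨q, fun hq0 => hp0 ?_, ?_⟩
  · apply Polynomial.map_injective E.subtype Subtype.val_injective
    rw [← hq, hq0, Polynomial.map_zero, Polynomial.map_zero]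
  · rw [Polynomial.aeval_def, ← Polynomial.eval_map, show algebraMap E' Ω = E'.subtype from rfl, hq,
      Polynomial.eval_map, show E.subtype = algebraMap E Ω from rfl, ← Polynomial.aeval_def, hpx]

/-- Descent of separability: a root of a separable polynomial over `E` whose coefficients lie
in `E'` is separable over `E'`. [folklore] -/
theorem isSeparable_of_coeff_mem {E E' : Subfield Ω} {x : Ω} {p : E[X]} (hsep : p.Separable)
    (hpx : Polynomial.aeval x p = 0) (h : ∀ n, ((p.coeff n : E) : Ω) ∈ E') :
    IsSeparable E' x := by
  obtain ⟨q, hq⟩ := exists_map_eq_map_of_coeff_mem p h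
  have hq0 : Polynomial.aeval x q = 0 := by
    rw [Polynomial.aeval_def, ← Polynomial.eval_map, show algebraMap E' Ω = E'.subtype from rfl, hq,
      Polynomial.eval_map, show E.subtype = algebraMap E Ω from rfl, ← Polynomial.aeval_def, hpx]
  have hqsep : q.Separable := by
    rw [← Polynomial.separable_map E'.subtype, hq]
    exact hsep.map
  exact hqsep.of_dvd (minpoly.dvd E' x hq0)

/-- **Finiteness of the data of an algebraic element.** If `x` is algebraic over `K(T)`, then
there is a finite `C ⊆ K` such that `x` is algebraic over `K'(T)` for every subfield
`K' ⊇ C`. [folklore] -/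
theorem exists_finset_isAlgebraic_adjoin {K : Subfield Ω} {T : Set Ω} {x : Ω}
    (hx : IsAlgebraic (IntermediateField.adjoin K T) x) :
    ∃ C : Finset Ω, (↑C : Set Ω) ⊆ K ∧ ∀ K' : Subfield Ω, (↑C : Set Ω) ⊆ K' →
      IsAlgebraic (IntermediateField.adjoin K' T) x := by
  classical
  rw [← isAlgebraic_closure_iff] at hx
  obtain ⟨p, hp0, hpx⟩ := hx
  have hcoef : ∀ n, ∃ C : Finset Ω, (↑C : Set Ω) ⊆ K ∧
      ((p.coeff n : _) : Ω) ∈ Subfield.closure (↑C ∪ T) := fun n =>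
    exists_finset_mem_closure_union (p.coeff n).2
  choose C hCK hCmem using hcoef
  refine ⟨p.support.biUnion C, ?_, fun K' hK' => ?_⟩
  · rw [Finset.coe_biUnion]
    exact Set.iUnion₂_subset fun n _ => hCK n
  · rw [← isAlgebraic_closure_iff]
    refine isAlgebraic_of_coeff_mem hp0 hpx fun n => ?_
    by_cases hn : n ∈ p.support
    · refine Subfield.closure_mono (Set.union_subset_union_left _ fun c hc => ?_) (hCmem n)
      exact hK' (by rw [Finset.coe_biUnion]; exact Set.mem_biUnion hn hc)
    · rw [Polynomial.notMem_support_iff.mp hn, ZeroMemClass.coe_zero]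
      exact zero_mem _

/-- **Finiteness of the data of a separable element.** If `x` is separable over `K(T)`, then
there is a finite `C ⊆ K` such that `x` is separable over `K'(T)` for every subfield
`K' ⊇ C`. [folklore] -/
theorem exists_finset_isSeparable_adjoin {K : Subfield Ω} {T : Set Ω} {x : Ω}
    (hx : IsSeparable (IntermediateField.adjoin K T) x) :
    ∃ C : Finset Ω, (↑C : Set Ω) ⊆ K ∧ ∀ K' : Subfield Ω, (↑C : Set Ω) ⊆ K' →
      IsSeparable (IntermediateField.adjoin K' T) x := by
  classical
  rw [← isSeparable_closure_iff] at hx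
  set p := minpoly (Subfield.closure ((K : Set Ω) ∪ T)) x with hp
  have hsep : p.Separable := hx
  have hpx : Polynomial.aeval x p = 0 := minpoly.aeval _ x
  have hcoef : ∀ n, ∃ C : Finset Ω, (↑C : Set Ω) ⊆ K ∧
      ((p.coeff n : _) : Ω) ∈ Subfield.closure (↑C ∪ T) := fun n =>
    exists_finset_mem_closure_union (p.coeff n).2
  choose C hCK hCmem using hcoef
  refine ⟨p.support.biUnion C, ?_, fun K' hK' => ?_⟩
  · rw [Finset.coe_biUnion]
    exact Set.iUnion₂_subset fun n _ => hCK n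
  · rw [← isSeparable_closure_iff]
    refine isSeparable_of_coeff_mem hsep hpx fun n => ?_
    by_cases hn : n ∈ p.support
    · refine Subfield.closure_mono (Set.union_subset_union_left _ fun c hc => ?_) (hCmem n)
      exact hK' (by rw [Finset.coe_biUnion]; exact Set.mem_biUnion hn hc)
    · rw [Polynomial.notMem_support_iff.mp hn, ZeroMemClass.coe_zero]
      exact zero_mem _

/-- Elements of `K(T)` lie in `C(T)` for a finite `C ⊆ K`, uniformly in `K' ⊇ C`. [folklore] -/
theorem exists_finset_mem_adjoin {K : Subfield Ω} {T : Set Ω} {x : Ω}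
    (hx : x ∈ Subfield.closure ((K : Set Ω) ∪ T)) :
    ∃ C : Finset Ω, (↑C : Set Ω) ⊆ K ∧ ∀ K' : Subfield Ω, (↑C : Set Ω) ⊆ K' →
      x ∈ Subfield.closure ((K' : Set Ω) ∪ T) := by
  obtain ⟨C, hCK, hxC⟩ := exists_finset_mem_closure_union hx
  exact ⟨C, hCK, fun K' hK' => Subfield.closure_mono (Set.union_subset_union_left _ hK') hxC⟩

end FieldLemmas

/-! ### Valuation lemmas -/

section ValuationLemmas

variable (V : ValuationSubring Ω)

/-- **Algebraic extensions do not enlarge the value group cofinally**: a non-zero element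
algebraic over `K` has value bounded below by the value of a non-zero element of `K`
(some power of its value lies in `vK`). [folklore] -/
theorem exists_valuation_le_of_isAlgebraic {K : Subfield Ω} {a : Ω}
    (ha : IsAlgebraic K a) (ha0 : a ≠ 0) :
    ∃ b ∈ K, b ≠ 0 ∧ V.valuation b ≤ V.valuation a := by
  by_cases h1 : 1 ≤ V.valuation a
  · exact ⟨1, one_mem K, one_ne_zero, by rwa [map_one]⟩
  obtain ⟨n, hn, b, hbK, hab⟩ := exists_valuation_pow_eq_of_isAlgebraic V ha ha0
  refine ⟨b, hbK, ?_, ?_⟩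
  · rintro rfl
    rw [map_zero, map_pow, pow_eq_zero_iff hn, map_eq_zero] at hab
    exact ha0 hab
  · rw [← hab, map_pow]
    exact pow_le_of_le_one zero_le (le_of_lt (not_le.mp h1)) hn

/-- Same, for every element of a subfield `F` algebraic over `K`: `vK` is cofinal in `vF`
(`IsValueCofinal`). [folklore] -/
theorem isValueCofinal_of_isAlgebraic {K F : Subfield Ω} (halg : ∀ a ∈ F, IsAlgebraic K a) :
    IsValueCofinal V K F := fun a haF ha0 =>
  exists_valuation_le_of_isAlgebraic V (halg a haF) ha0

/-- **Kuhlmann 2016, Lemma 2.2 (value part) over the prime field**: if the residues of the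
`yⱼ ∈ V` are algebraically independent over the residue field of the prime field `ℙ`, then
every non-zero element of `ℙ(y)` has the value of an element of `ℙ` (Knaf–Kuhlmann 2005,
Thm. 2.1, `exists_valuation_eq_of_mem_closure` with no `xᵢ`). [cite: Kuhlmann2016, Lemma 2.2] -/
theorem exists_valuation_eq_bot_of_mem_closure {κ : Type*} {y : κ → Ω} (hy : ∀ j, y j ∈ V)
    (hri : AlgebraicIndependent (resField V ⊥) (fun j => residue V ⟨y j, hy j⟩))
    {a : Ω} (ha : a ∈ Subfield.closure (Set.range y)) (ha0 : a ≠ 0) :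
    ∃ b ∈ (⊥ : Subfield Ω), V.valuation a = V.valuation b := by
  have ha' : a ∈ Subfield.closure (((⊥ : Subfield Ω) : Set Ω) ∪
      (Set.range (fun i : Empty => (i.elim : Ω)) ∪ Set.range y)) :=
    Subfield.closure_mono (fun z hz => Or.inr (Or.inr hz)) ha
  obtain ⟨m, b, hb, hv⟩ := exists_valuation_eq_of_mem_closure V ⊥ (x := fun i : Empty => (i.elim : Ω))
    (fun i => i.elim) (fun m _ => funext fun i => i.elim) hy hri ha' ha0
  refine ⟨b, hb, ?_⟩
  rw [hv, Finset.univ_eq_empty, Finset.prod_empty, mul_one]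

/-- **Adjoining an element of infinitesimal value.** If `b ≠ 0` has value below the value of
every non-zero element of the subfield `E`, then every non-zero element of `E(b)` has value
`v(c) · v(b)^k` with `c ∈ E` and `k ∈ ℤ` (Knaf–Kuhlmann 2005, Thm. 2.1 with the single
value-independent element `b`: `vE(b) = vE ⊕ ℤ v(b)`). [folklore] -/
theorem exists_valuation_eq_of_infinitesimal {E : Subfield Ω} {b : Ω} (hb0 : b ≠ 0)
    (hb : ∀ c ∈ E, c ≠ 0 → V.valuation b < V.valuation c)
    {a : Ω} (ha : a ∈ Subfield.closure ((E : Set Ω) ∪ {b})) (ha0 : a ≠ 0) :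
    ∃ (k : ℤ), ∃ c ∈ E, c ≠ 0 ∧ V.valuation a = V.valuation c * V.valuation b ^ k := by
  have hri : AlgebraicIndependent (resField V E)
      (fun j : Empty => residue V ⟨((fun i : Empty => (i.elim : Ω)) j), j.elim⟩) :=
    algebraicIndependent_empty_type_iff.mpr Subtype.val_injective
  have hvb0 : V.valuation b ≠ 0 := (map_ne_zero V.valuation).mpr hb0
  have hb1 : V.valuation b < 1 := by
    have := hb 1 (one_mem E) one_ne_zero
    rwa [map_one] at this
  -- no positive power of `v(b)` is a value of `E`
  have hpow : ∀ (n : ℕ) (c : Ω), c ∈ E → V.valuation b ^ n = V.valuation c → n = 0 := by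
    intro n c hcE hc
    by_contra hn
    have hc0 : c ≠ 0 := by
      rintro rfl
      rw [map_zero, pow_eq_zero_iff hn] at hc
      exact hvb0 hc
    have h1 : V.valuation b ^ n ≤ V.valuation b := pow_le_of_le_one zero_le hb1.le hn
    exact absurd (hc ▸ h1) (not_le.mpr (hb c hcE hc0))
  have hxi : ∀ m : Unit → ℤ, (∃ c ∈ E, (∏ i, V.valuation ((fun _ : Unit => b) i) ^ (m i)) =
      V.valuation c) → m = 0 := by
    rintro m ⟨c, hcE, hc⟩
    rw [Fintype.prod_unique] at hc
    change V.valuation b ^ m default = V.valuation c at hc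
    funext i
    rw [Unique.eq_default i]
    change m default = 0
    rcases Int.eq_nat_or_neg (m default) with ⟨n, hn | hn⟩
    · rw [hn, zpow_natCast] at hc
      rw [hn, hpow n c hcE hc, Nat.cast_zero]
    · rw [hn, zpow_neg, zpow_natCast] at hc
      have hc' : V.valuation b ^ n = V.valuation c⁻¹ := by rw [map_inv₀, ← hc, inv_inv]
      rw [hn, hpow n c⁻¹ (inv_mem hcE) hc', Nat.cast_zero, neg_zero]
  have ha' : a ∈ Subfield.closure ((E : Set Ω) ∪
      (Set.range (fun _ : Unit => b) ∪ Set.range (fun i : Empty => (i.elim : Ω)))) := by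
    refine Subfield.closure_mono ?_ ha
    rintro z (hz | hz)
    · exact Or.inl hz
    · refine Or.inr (Or.inl ?_)
      rw [Set.mem_singleton_iff] at hz
      exact ⟨(), hz.symm⟩
  obtain ⟨m, c, hcE, hv⟩ := exists_valuation_eq_of_mem_closure V E (x := fun _ : Unit => b)
    (y := fun i : Empty => (i.elim : Ω)) (fun _ => hb0) hxi (fun i => i.elim) hri ha' ha0
  refine ⟨m default, c, hcE, ?_, ?_⟩
  · rintro rfl
    rw [map_zero, zero_mul] at hv
    exact ha0 ((map_eq_zero V.valuation).mp hv)
  · rw [hv, Fintype.prod_unique]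

/-- In the situation of `exists_valuation_eq_of_infinitesimal`, the powers of `b` have values
cofinal (from below) in `vE(b)`. [folklore] -/
theorem exists_valuation_pow_le_of_infinitesimal {E : Subfield Ω} {b : Ω} (hb0 : b ≠ 0)
    (hb : ∀ c ∈ E, c ≠ 0 → V.valuation b < V.valuation c)
    {a : Ω} (ha : a ∈ Subfield.closure ((E : Set Ω) ∪ {b})) (ha0 : a ≠ 0) :
    ∃ n : ℕ, V.valuation (b ^ n) ≤ V.valuation a := by
  obtain ⟨k, c, hcE, hc0, hv⟩ := exists_valuation_eq_of_infinitesimal V hb0 hb ha ha0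
  have hvb0 : V.valuation b ≠ 0 := (map_ne_zero V.valuation).mpr hb0
  have hvbpos : 0 < V.valuation b := zero_lt_iff.mpr hvb0
  have hb1 : V.valuation b < 1 := by
    have := hb 1 (one_mem E) one_ne_zero
    rwa [map_one] at this
  -- `v(a) = v(c) v(b)^k > v(b)^(k+1)`
  have hlt : V.valuation b ^ (k + 1) < V.valuation a := by
    rw [hv, zpow_add_one₀ hvb0, mul_comm]
    exact mul_lt_mul_of_pos_right (hb c hcE hc0) (zpow_pos hvbpos k)
  rcases Int.eq_nat_or_neg (k + 1) with ⟨n, hn | hn⟩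
  · refine ⟨n, ?_⟩
    rw [map_pow, ← zpow_natCast, ← hn]
    exact hlt.le
  · refine ⟨0, ?_⟩
    rw [pow_zero, map_one]
    refine le_trans ?_ hlt.le
    rw [hn, zpow_neg, zpow_natCast, one_le_inv₀ (pow_pos hvbpos n)]
    exact pow_le_one₀ zero_le hb1.le

end ValuationLemmas


/-! ### Finite rank -/

section FiniteRank

variable (V : ValuationSubring Ω)

/-- An element of a subfield `M` lying in the prime subfield of `Ω` lies in the prime subfield
of `M`. [folklore] -/
theorem mem_bot_of_coe_mem_bot {M : Subfield Ω} {x : M} (hx : (x : Ω) ∈ (⊥ : Subfield Ω)) :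
    x ∈ (⊥ : Subfield M) := by
  have h : (⊥ : Subfield Ω) ≤ (⊥ : Subfield M).map M.subtype := by
    rw [Subfield.map_bot]
  obtain ⟨y, hy, hyx⟩ := Subfield.mem_map.mp (h hx)
  have : y = x := Subtype.val_injective hyx
  exact this ▸ hy

open scoped IntermediateField.algebraAdjoinAdjoin in
/-- **Finite rank engine** (the mechanism of the proof of Kuhlmann 2016, Cor. 3.8: "As a
finitely generated field, `(K₁,v)` has finite rank … According to Lemma 2.2, the field
`K₁(y_j | j ∈ J)` has … the same value group as `K₁`, hence it is again a field of finite rank …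
As an algebraic extension of a field of finite rank, it is itself of finite rank"). Rendering:
let `K' ≤ M` be subfields of `(Ω, V)` such that every value of `K'` is a value of the prime field
`ℙ` (e.g. `K' = ℙ(y_j | j ∈ J)` for residue-transcendental `y_j`,
`exists_valuation_eq_bot_of_mem_closure`), and let `M` be algebraic over `K'(A)` for a finite set
`A`. Then `(M, V ∩ M)` has finite rank (`HasFiniteRank`). PROVED: inside the field `M`, the
overrings of `V ∩ M` meet `K'` in at most two ways (they meet `ℙ` in at most two ways,
`bot_subset_of_mem_of_not_mem`, and `K'ˣ ⊆ ℙˣ · (V ∩ M)ˣ`), and `tr.deg_{K'} M ≤ #A < ∞`, so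
Kuhlmann 2010, Cor. 2.7 in the relative form `finite_overrings_of_subfield` applies.
[cite: Kuhlmann2016, Cor. 3.8 (proof)] -/
theorem hasFiniteRank_of_isAlgebraic_closure {K' M : Subfield Ω} (A : Finset Ω)
    (hK'M : K' ≤ M) (hAM : (↑A : Set Ω) ⊆ M)
    (hval : ∀ a ∈ K', a ≠ 0 → ∃ b ∈ (⊥ : Subfield Ω), V.valuation a = V.valuation b)
    (halg : ∀ x ∈ M, IsAlgebraic (Subfield.closure ((K' : Set Ω) ∪ A)) x) :
    HasFiniteRank V M := by
  classical
  set VM : ValuationSubring M := V.comap (algebraMap M Ω) with hVM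
  set Kd : Subfield M := K'.comap M.subtype with hKd
  have hmemVM : ∀ y : M, y ∈ VM ↔ (y : Ω) ∈ V := fun y => Iff.rfl
  have hmemKd : ∀ y : M, y ∈ Kd ↔ (y : Ω) ∈ K' := fun y => Iff.rfl
  -- (1) the overrings of `VM` meet `Kd` in at most two ways
  have key : ∀ d : M, d ∈ Kd → d ≠ 0 →
      ∃ e : M, e ∈ (⊥ : Subfield M) ∧ e ≠ 0 ∧ d / e ∈ VM ∧ e / d ∈ VM := by
    intro d hdK hd0
    have hd0' : (d : Ω) ≠ 0 := fun h0 => hd0 (Subtype.val_injective (by rw [h0]; rfl))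
    obtain ⟨b, hb, hvb⟩ := hval d ((hmemKd d).mp hdK) hd0'
    have hbM : b ∈ M := (bot_le : (⊥ : Subfield Ω) ≤ M) hb
    have hvb0 : V.valuation b ≠ 0 := by
      rw [← hvb]
      exact (map_ne_zero V.valuation).mpr hd0'
    refine ⟨⟨b, hbM⟩, mem_bot_of_coe_mem_bot hb, ?_, ?_, ?_⟩
    · intro h0
      apply hvb0
      rw [show b = 0 from congrArg Subtype.val h0, map_zero]
    · rw [hmemVM, ← V.valuation_le_one_iff]
      change V.valuation ((d : Ω) / b) ≤ 1
      rw [map_div₀, hvb, div_self hvb0]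
    · rw [hmemVM, ← V.valuation_le_one_iff]
      change V.valuation (b / (d : Ω)) ≤ 1
      rw [map_div₀, hvb, div_self hvb0]
  have hK : ∀ S : ValuationSubring M, VM ≤ S →
      (∀ c ∈ Kd, c ∈ S) ∨ (∀ c ∈ Kd, c ∈ S ↔ c ∈ VM) := by
    intro S hVS
    by_cases h : ∃ c ∈ Kd, c ∈ S ∧ c ∉ VM
    · obtain ⟨c, hcK, hcS, hcV⟩ := h
      left
      have hc0 : c ≠ 0 := fun h0 => hcV (h0 ▸ zero_mem VM)
      obtain ⟨e, hebot, he0, hde, hed⟩ := key c hcK hc0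
      have heS : e ∈ S := by
        have : e = (e / c) * c := by field_simp
        rw [this]
        exact mul_mem (hVS hed) hcS
      have heV : e ∉ VM := fun heV => hcV (by
        have : c = (c / e) * e := by field_simp
        rw [this]
        exact mul_mem hde heV)
      have hbotS := bot_subset_of_mem_of_not_mem hVS hebot heS heV
      intro d hdK
      by_cases hd0 : d = 0
      · rw [hd0]; exact zero_mem S
      obtain ⟨e', he'bot, he'0, hde', -⟩ := key d hdK hd0
      have : d = (d / e') * e' := by field_simp
      rw [this]
      exact mul_mem (hVS hde') (hbotS e' he'bot)
    · push Not at h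
      exact Or.inr fun c hc => ⟨fun hcS => h c hc hcS, fun hcV => hVS hcV⟩
  -- (2) `tr.deg_{Kd} M ≤ #A`
  have htr : Algebra.trdeg Kd M < Cardinal.aleph0 := by
    set Ad : Set M := ((↑) : M → Ω) ⁻¹' (↑A : Set Ω) with hAd
    have hAdfin : Ad.Finite :=
      (A.finite_toSet).preimage (Set.injOn_of_injective Subtype.val_injective)
    set E : Subfield Ω := Subfield.closure ((K' : Set Ω) ∪ A) with hE
    set R : IntermediateField Kd M := IntermediateField.adjoin Kd Ad with hR
    -- the elements of `R = Kd(Ad)` are those of `E = K'(A)`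
    have hRE : ∀ r : M, r ∈ R → (r : Ω) ∈ E := by
      intro r hr
      rw [hR, mem_adjoin_subfield_iff] at hr
      have hle : Subfield.closure ((Kd : Set M) ∪ Ad) ≤ E.comap M.subtype := by
        rw [Subfield.closure_le]
        rintro z (hz | hz)
        · exact Subfield.subset_closure (Or.inl hz)
        · exact Subfield.subset_closure (Or.inr hz)
      exact hle hr
    let f : R →+* E :=
      { toFun := fun r => ⟨((r : M) : Ω), hRE r r.2⟩
        map_one' := rfl
        map_mul' := fun _ _ => rfl
        map_zero' := rfl
        map_add' := fun _ _ => rfl }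
    have hf : Function.Surjective f := by
      rintro ⟨z, hz⟩
      have hle : E ≤ (Subfield.closure ((Kd : Set M) ∪ Ad)).map M.subtype := by
        rw [RingHom.map_field_closure, hE, Subfield.closure_le]
        rintro w (hw | hw)
        · exact Subfield.subset_closure ⟨⟨w, hK'M hw⟩, Or.inl hw, rfl⟩
        · exact Subfield.subset_closure ⟨⟨w, hAM hw⟩, Or.inr hw, rfl⟩
      obtain ⟨r, hr, hrz⟩ := Subfield.mem_map.mp (hle hz)
      exact ⟨⟨r, (mem_adjoin_subfield_iff Kd Ad r).mpr hr⟩, Subtype.ext hrz⟩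
    haveI : Algebra.IsAlgebraic R M := ⟨fun y =>
      IsAlgebraic.of_ringHom_of_comp_eq f M.subtype (halg y y.2) hf Subtype.val_injective
        (RingHom.ext fun _ => rfl)⟩
    haveI : Algebra.IsAlgebraic (Algebra.adjoin Kd Ad) M :=
      Algebra.IsAlgebraic.trans (Algebra.adjoin Kd Ad) R M
    have h := Algebra.IsAlgebraic.trdeg_le_cardinalMk Kd Ad (A := M)
    exact h.trans_lt (Cardinal.lt_aleph0_iff_set_finite.mpr hAdfin)
  exact finite_overrings_of_subfield VM Kd hK htr

/-- **A valued field of finite rank has a value that dominates all others**: if `(M, V ∩ M)`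
has finite rank, there is a non-zero `a₀ ∈ M`, `v(a₀) ≤ 1`, such that every non-zero element
of `M` has value `≥ v(a₀)^n` for some `n` (the convex subgroup generated by `v(a₀)` is the
whole value group: `vM` has a biggest proper convex subgroup or is trivial). PROVED: otherwise
the valuation rings `O(a) = {y ∈ M : v(y) ≤ v(a)^{-n} for some n}` of the coarsenings by the
convex subgroups generated by the values `v(a)` of a suitable sequence of elements form an
infinite strictly increasing chain of overrings of `V ∩ M`. [folklore] -/
theorem exists_dominating_of_hasFiniteRank {M : Subfield Ω} (hM : HasFiniteRank V M) :
    ∃ a₀ ∈ M, a₀ ≠ 0 ∧ V.valuation a₀ ≤ 1 ∧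
      ∀ c ∈ M, c ≠ 0 → ∃ n : ℕ, V.valuation a₀ ^ n ≤ V.valuation c := by
  classical
  by_contra H
  push Not at H
  -- `H : ∀ a₀ ∈ M, a₀ ≠ 0 → v a₀ ≤ 1 → ∃ c ∈ M, c ≠ 0 ∧ ∀ n, v c < v a₀ ^ n`
  -- the type of admissible elements and the attached overrings of `V ∩ M`
  let T := {a : Ω // a ∈ M ∧ a ≠ 0 ∧ V.valuation a ≤ 1}
  let Ov : T → ValuationSubring M := fun a =>
    { carrier := {y : M | ∃ n : ℕ, V.valuation (y : Ω) * V.valuation (a : Ω) ^ n ≤ 1}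
      mul_mem' := by
        rintro y z ⟨n, hn⟩ ⟨m, hm⟩
        refine ⟨n + m, ?_⟩
        rw [Subfield.coe_mul, map_mul, pow_add, mul_mul_mul_comm]
        exact mul_le_one' hn hm
      one_mem' := ⟨0, by rw [Subfield.coe_one, map_one, pow_zero, mul_one]⟩
      add_mem' := by
        rintro y z ⟨n, hn⟩ ⟨m, hm⟩
        refine ⟨n + m, ?_⟩
        have han : V.valuation (a : Ω) ^ m ≤ 1 := pow_le_one₀ zero_le a.2.2.2
        have ham : V.valuation (a : Ω) ^ n ≤ 1 := pow_le_one₀ zero_le a.2.2.2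
        have hy : V.valuation (y : Ω) * V.valuation (a : Ω) ^ (n + m) ≤ 1 := by
          rw [pow_add, ← mul_assoc]
          exact mul_le_one' hn han
        have hz : V.valuation (z : Ω) * V.valuation (a : Ω) ^ (n + m) ≤ 1 := by
          rw [pow_add, mul_comm (V.valuation (a : Ω) ^ n), ← mul_assoc]
          exact mul_le_one' hm ham
        rw [Subfield.coe_add]
        calc V.valuation ((y : Ω) + z) * V.valuation (a : Ω) ^ (n + m)
            ≤ max (V.valuation (y : Ω)) (V.valuation (z : Ω)) * V.valuation (a : Ω) ^ (n + m) := by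
              gcongr
              exact Valuation.map_add _ _ _
          _ ≤ 1 := by
              rcases le_total (V.valuation (y : Ω)) (V.valuation (z : Ω)) with h | h
              · rw [max_eq_right h]; exact hz
              · rw [max_eq_left h]; exact hy
      zero_mem' := ⟨0, by rw [ZeroMemClass.coe_zero, map_zero, zero_mul]; exact zero_le⟩
      neg_mem' := by
        rintro y ⟨n, hn⟩
        exact ⟨n, by rwa [Subfield.coe_neg, Valuation.map_neg]⟩
      mem_or_inv_mem' := by
        intro y
        by_cases hy : V.valuation (y : Ω) ≤ 1
        · exact Or.inl ⟨0, by rwa [pow_zero, mul_one]⟩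
        · refine Or.inr ⟨0, ?_⟩
          rw [pow_zero, mul_one, Subfield.coe_inv, map_inv₀]
          exact inv_le_one_of_one_le₀ (not_le.mp hy).le }
  have hleOv : ∀ a : T, V.comap (algebraMap M Ω) ≤ Ov a := fun a y hy =>
    ⟨0, by
      rw [pow_zero, mul_one]
      exact (V.valuation_le_one_iff _).mpr hy⟩
  -- the successor map and the sequence
  have hnext : ∀ a : T, ∃ c : T, (∀ n : ℕ, V.valuation (c : Ω) < V.valuation (a : Ω) ^ n) := by
    rintro ⟨a, haM, ha0, ha1⟩
    obtain ⟨c, hcM, hc0, hc'⟩ := H a haM ha0 ha1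
    have hc1 : V.valuation c ≤ 1 := by
      have := hc' 0
      rw [pow_zero] at this
      exact this.le
    exact ⟨⟨c, hcM, hc0, hc1⟩, hc'⟩
  choose next hnext using hnext
  let seq : ℕ → T := fun n => next^[n] ⟨1, one_mem M, one_ne_zero, by rw [map_one]⟩
  have hseq : ∀ n, seq (n + 1) = next (seq n) := fun n => Function.iterate_succ_apply' next n _
  -- the attached chain of overrings
  let O : ℕ → {S : ValuationSubring M // V.comap (algebraMap M Ω) ≤ S} := fun n =>
    ⟨Ov (seq n), hleOv _⟩
  have hmono : StrictMono O := by
    refine strictMono_nat_of_lt_succ fun n => ?_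
    have hlt : ∀ k : ℕ, V.valuation ((seq (n + 1) : T) : Ω) < V.valuation ((seq n : T) : Ω) ^ k := by
      rw [hseq]
      exact hnext (seq n)
    have hle : (O n).1 ≤ (O (n + 1)).1 := by
      rintro y ⟨k, hk⟩
      refine ⟨k, le_trans ?_ hk⟩
      gcongr
      · exact zero_le
      · have := hlt 1
        rw [pow_one] at this
        exact this.le
    refine lt_of_le_of_ne hle fun heq => ?_
    -- `c⁻¹ ∈ O (n+1) ∖ O n` for `c = seq (n+1)`
    set c : Ω := ((seq (n + 1) : T) : Ω) with hc
    have hcM : c ∈ M := (seq (n + 1)).2.1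
    have hc0 : c ≠ 0 := (seq (n + 1)).2.2.1
    have hvc0 : V.valuation c ≠ 0 := (map_ne_zero V.valuation).mpr hc0
    have hmem : (⟨c⁻¹, inv_mem hcM⟩ : M) ∈ (O (n + 1)).1 := by
      refine ⟨1, ?_⟩
      change V.valuation c⁻¹ * V.valuation c ^ 1 ≤ 1
      rw [pow_one, map_inv₀, inv_mul_cancel₀ hvc0]
    have hnmem : (⟨c⁻¹, inv_mem hcM⟩ : M) ∉ (O n).1 := by
      rintro ⟨k, hk⟩
      change V.valuation c⁻¹ * V.valuation ((seq n : T) : Ω) ^ k ≤ 1 at hk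
      rw [map_inv₀, inv_mul_le_one₀ (zero_lt_iff.mpr hvc0)] at hk
      exact absurd hk (not_le.mpr (hlt k))
    rw [Subtype.ext_iff.mp heq] at hnmem
    exact hnmem hmem
  haveI : Finite {S : ValuationSubring M // V.comap (algebraMap M Ω) ≤ S} := hM
  exact not_injective_infinite_finite O hmono.injective

end FiniteRank


/-! ### Residue-transcendence bases -/

section ResidueBasis

variable (V : ValuationSubring Ω)

/-- Algebraic independence over a subfield persists over any smaller subfield. [folklore] -/
theorem algebraicIndependent_of_subfield_le {L : Type*} [Field L] {k k' : Subfield L}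
    (h : k ≤ k') {ι : Type*} {x : ι → L} (hx : AlgebraicIndependent k' x) :
    AlgebraicIndependent k x := by
  letI : Algebra k k' := (Subfield.inclusion h).toAlgebra
  haveI : IsScalarTower k k' L := IsScalarTower.of_algebraMap_eq fun _ => rfl
  exact hx.restrictScalars (Subfield.inclusion h).injective

/-- **Lifting a transcendence basis of the residue field extension** (Kuhlmann 2016, proof of
Cor. 3.8: "let `y_j`, `j ∈ J`, be a system of elements in `K` such that the residues `y_j v`,
`j ∈ J`, form a transcendence basis of `Kv` over `K₁v`"). For subfields `K₁ ≤ K` of `(Ω, V)`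
there is a family `y` of elements of `V ∩ K` whose residues are algebraically independent over
`K₁v = resField V K₁` and such that `Kv` is algebraic over `K₁v(yv)`. PROVED (Mathlib's
`exists_isTranscendenceBasis` for `Kv | K₁v`, lifted along the residue map).
[cite: Kuhlmann2016, Cor. 3.8 (proof)] -/
theorem exists_residue_transcendence_family {K₁ K : Subfield Ω} (hK₁K : K₁ ≤ K) :
    ∃ (κ : Type u) (y : κ → Ω) (hyV : ∀ j, y j ∈ V), (∀ j, y j ∈ K) ∧
      AlgebraicIndependent (resField V K₁) (fun j => residue V ⟨y j, hyV j⟩) ∧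
      ∀ r ∈ resField V K, IsAlgebraic
        (Subfield.closure ((resField V K₁ : Set (ResidueField V)) ∪
          Set.range (fun j => (residue V ⟨y j, hyV j⟩ : ResidueField V)))) r := by
  classical
  set k₁ : Subfield (ResidueField V) := resField V K₁ with hk₁
  set kK : Subfield (ResidueField V) := resField V K with hkK
  have hk : k₁ ≤ kK := resField_mono V hK₁K
  letI : Algebra k₁ kK := (Subfield.inclusion hk).toAlgebra
  haveI : IsScalarTower k₁ kK (ResidueField V) := IsScalarTower.of_algebraMap_eq fun _ => rfl
  haveI : FaithfulSMul k₁ kK :=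
    (faithfulSMul_iff_algebraMap_injective k₁ kK).mpr (Subfield.inclusion hk).injective
  obtain ⟨sK, hsK⟩ := exists_isTranscendenceBasis k₁ kK
  -- lift the basis along the residue map
  have hl : ∀ z : sK, ∃ a : V, (a : Ω) ∈ K ∧ residue V a = ((z : kK) : ResidueField V) :=
    fun z => (mem_resField_iff V K _).mp (z : kK).2
  choose yV hyK hyres using hl
  refine ⟨sK, fun z => (yV z : Ω), fun z => (yV z).2, hyK, ?_, ?_⟩
  · -- algebraic independence of the residues
    have hfam : (fun j : sK => residue V ⟨(yV j : Ω), (yV j).2⟩) =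
        (IsScalarTower.toAlgHom k₁ kK (ResidueField V)) ∘ ((↑) : sK → kK) := by
      funext j
      simp only [Function.comp_apply, Subtype.coe_eta, hyres]
      rfl
    rw [hfam]
    exact hsK.1.map' (f := IsScalarTower.toAlgHom k₁ kK (ResidueField V)) Subtype.val_injective
  · -- `Kv` is algebraic over `K₁v(yv)`
    intro r hr
    set E : Subfield (ResidueField V) := Subfield.closure ((k₁ : Set (ResidueField V)) ∪
      Set.range (fun j : sK => (residue V ⟨(yV j : Ω), (yV j).2⟩ : ResidueField V))) with hE
    haveI := hsK.isAlgebraic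
    set R := Algebra.adjoin k₁ (Set.range ((↑) : sK → kK)) with hR
    -- the elements of `R` lie in `E`
    let S₀ : Subalgebra k₁ kK :=
      { carrier := {q | (q : ResidueField V) ∈ E}
        mul_mem' := fun {a b} ha hb => by
          change ((a * b : kK) : ResidueField V) ∈ E
          rw [Subfield.coe_mul]; exact mul_mem ha hb
        one_mem' := by change ((1 : kK) : ResidueField V) ∈ E; rw [Subfield.coe_one]; exact one_mem E
        add_mem' := fun {a b} ha hb => by
          change ((a + b : kK) : ResidueField V) ∈ E
          rw [Subfield.coe_add]; exact add_mem ha hb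
        zero_mem' := by change ((0 : kK) : ResidueField V) ∈ E; rw [ZeroMemClass.coe_zero]; exact zero_mem E
        algebraMap_mem' := fun c => Subfield.subset_closure (Or.inl c.2) }
    have hRS : R ≤ S₀ := by
      rw [hR, Algebra.adjoin_le_iff]
      rintro q ⟨j, rfl⟩
      refine Subfield.subset_closure (Or.inr ⟨j, ?_⟩)
      change residue V ⟨(yV j : Ω), (yV j).2⟩ = ((j : kK) : ResidueField V)
      rw [Subtype.coe_eta, hyres]
    let f : R →+* E :=
      { toFun := fun q => ⟨((q : kK) : ResidueField V), hRS q.2⟩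
        map_one' := rfl
        map_mul' := fun _ _ => rfl
        map_zero' := rfl
        map_add' := fun _ _ => rfl }
    have hf : Function.Injective f := by
      intro a b hab
      apply Subtype.ext
      apply Subtype.ext
      exact congrArg (fun e : E => (e : ResidueField V)) hab
    have halg : IsAlgebraic R (⟨r, hr⟩ : kK) := Algebra.IsAlgebraic.isAlgebraic _
    exact halg.ringHom_of_comp_eq f kK.subtype hf (RingHom.ext fun _ => rfl)

/-- If `Kv` is algebraic over `K₁v(yv)` and `K₀ ⊇ K₁ ∪ {y_j}`, then `Kv | K₀v` is algebraic
(`IsResiduallyAlgebraicOver`). [folklore] -/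
theorem isResiduallyAlgebraicOver_of_residue_family {K₁ K₀ K : Subfield Ω} (hK₁K₀ : K₁ ≤ K₀)
    {κ : Type*} {y : κ → Ω} (hyV : ∀ j, y j ∈ V) (hyK₀ : ∀ j, y j ∈ K₀)
    (halg : ∀ r ∈ resField V K, IsAlgebraic
      (Subfield.closure ((resField V K₁ : Set (ResidueField V)) ∪
        Set.range (fun j => (residue V ⟨y j, hyV j⟩ : ResidueField V)))) r) :
    IsResiduallyAlgebraicOver V K₀ K := by
  intro r hr
  refine isAlgebraic_of_subfield_le ?_ (halg r hr)
  rw [Subfield.closure_le]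
  rintro ρ (hρ | ⟨j, rfl⟩)
  · exact resField_mono V hK₁K₀ hρ
  · exact residue_mem_resField V ⟨y j, hyV j⟩ (hyK₀ j)

end ResidueBasis

/-! ### The construction of Cor. 3.8 / Cor. 3.16 -/

section Construction

variable (V : ValuationSubring Ω)

/-- **The construction of Kuhlmann 2016, Cor. 3.8, for given finite data.** For `K ≤ F = K(s)`
inside `(Ω, V)`, `t ∈ F`, a family `y` in `V ∩ K` with residues algebraically independent over
the residue field of the prime field `ℙ`, and a finite `A ⊆ K` containing the coefficients
needed to make the generators `s` algebraic over `K'(t)` for every `K' ⊇ A`: with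
`K₀ := K ∩ (ℙ(A, y))^{alg}` (the relative algebraic closure of `K₂ = ℙ(A, y)` in `K`) and
`F₀ := K₀(t, s)`, the subfield `K₀` contains `A` and the `y_j`, is relatively algebraically
closed in `K`, `K₀` and `F₀` have finite rank (`hasFiniteRank_of_isAlgebraic_closure`),
`K₀ ≤ F₀ ≤ F`, `F₀|K₀` is finitely generated and algebraic over `K₀(t)`, and `F₀.K = F`.
[cite: Kuhlmann2016, Cor. 3.8 (proof)] -/
theorem cor38_construction {K F : Subfield Ω} {t : Ω} {s : Finset Ω}
    (hKF : K ≤ F) (hsF : Subfield.closure ((K : Set Ω) ∪ s) = F) (htF : t ∈ F)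
    {κ : Type*} {y : κ → Ω} (hyK : ∀ j, y j ∈ K) (hyV : ∀ j, y j ∈ V)
    (hri : AlgebraicIndependent (resField V ⊥) (fun j => residue V ⟨y j, hyV j⟩))
    {A : Finset Ω} (hAK : (↑A : Set Ω) ⊆ K)
    (hCg : ∀ g ∈ s, ∀ K' : Subfield Ω, (↑A : Set Ω) ⊆ K' →
      IsAlgebraic (IntermediateField.adjoin K' ({t} : Set Ω)) g)
    {K₀ F₀ : Subfield Ω}
    (hK₀ : K₀ = K ⊓ (algebraicClosure (Subfield.closure ((↑A : Set Ω) ∪ Set.range y)) Ω).toSubfield)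
    (hF₀ : F₀ = Subfield.closure ((K₀ : Set Ω) ∪ insert t (↑s : Set Ω))) :
    K₀ ≤ K ∧ (↑A : Set Ω) ⊆ K₀ ∧ (∀ j, y j ∈ K₀) ∧
      (∀ a ∈ K₀, IsAlgebraic (Subfield.closure ((↑A : Set Ω) ∪ Set.range y)) a) ∧
      (∀ a ∈ K, IsAlgebraic K₀ a → a ∈ K₀) ∧
      HasFiniteRank V K₀ ∧ K₀ ≤ F₀ ∧ F₀ ≤ F ∧ t ∈ F₀ ∧ (↑s : Set Ω) ⊆ F₀ ∧ FGOver K₀ F₀ ∧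
      (∀ z ∈ F₀, IsAlgebraic (IntermediateField.adjoin K₀ ({t} : Set Ω)) z) ∧ F₀ ⊔ K = F ∧
      HasFiniteRank V F₀ := by
  classical
  set K₂ : Subfield Ω := Subfield.closure ((↑A : Set Ω) ∪ Set.range y) with hK₂
  have hsF' : (↑s : Set Ω) ⊆ F := fun x hx => hsF ▸ Subfield.subset_closure (Or.inr hx)
  have hK₂K : K₂ ≤ K := by
    rw [hK₂, Subfield.closure_le]
    rintro x (hx | ⟨j, rfl⟩)
    · exact hAK hx
    · exact hyK j
  have hK₀K : K₀ ≤ K := hK₀ ▸ inf_le_left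
  have hK₂K₀ : K₂ ≤ K₀ := by
    rw [hK₀]
    refine le_inf hK₂K fun x hx => ?_
    rw [IntermediateField.mem_toSubfield, mem_algebraicClosure_iff]
    exact isAlgebraic_algebraMap (⟨x, hx⟩ : K₂)
  have hAK₀ : (↑A : Set Ω) ⊆ K₀ := fun x hx => hK₂K₀ (Subfield.subset_closure (Or.inl hx))
  have hyK₀ : ∀ j, y j ∈ K₀ := fun j => hK₂K₀ (Subfield.subset_closure (Or.inr ⟨j, rfl⟩))
  have halgK₀ : ∀ a ∈ K₀, IsAlgebraic K₂ a := by
    intro a ha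
    rw [hK₀] at ha
    have h2 := (Subfield.mem_inf.mp ha).2
    rw [IntermediateField.mem_toSubfield, mem_algebraicClosure_iff] at h2
    exact h2
  have hrel : ∀ a ∈ K, IsAlgebraic K₀ a → a ∈ K₀ := by
    intro a haK ha
    have ha2 : IsAlgebraic K₂ a := isAlgebraic_trans_subfield hK₂K₀ halgK₀ ha
    rw [hK₀]
    refine Subfield.mem_inf.mpr ⟨haK, ?_⟩
    rw [IntermediateField.mem_toSubfield, mem_algebraicClosure_iff]
    exact ha2
  -- the subfield `K' = ℙ(y)`, with values in `vℙ`
  set K' : Subfield Ω := Subfield.closure (Set.range y) with hK'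
  have hK'K₂ : K' ≤ K₂ := Subfield.closure_mono Set.subset_union_right
  have hval : ∀ a ∈ K', a ≠ 0 → ∃ b ∈ (⊥ : Subfield Ω), V.valuation a = V.valuation b :=
    fun a ha ha0 => exists_valuation_eq_bot_of_mem_closure V hyV hri ha ha0
  have hK₂le : ∀ T : Set Ω, (↑A : Set Ω) ⊆ T → K₂ ≤ Subfield.closure ((K' : Set Ω) ∪ T) := by
    intro T hAT
    rw [hK₂, Subfield.closure_le]
    rintro x (hx | hx)
    · exact Subfield.subset_closure (Or.inr (hAT hx))
    · exact Subfield.subset_closure (Or.inl (Subfield.subset_closure hx))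
  have hfrK₀ : HasFiniteRank V K₀ :=
    hasFiniteRank_of_isAlgebraic_closure V A (hK'K₂.trans hK₂K₀) hAK₀ hval fun x hx =>
      isAlgebraic_of_subfield_le (hK₂le _ subset_rfl) (halgK₀ x hx)
  -- generators are algebraic over every subfield containing `A` and `t`
  have hgen' : ∀ L : Subfield Ω, (↑A : Set Ω) ⊆ L → t ∈ L → ∀ g ∈ (↑s : Set Ω),
      IsAlgebraic L g := by
    intro L hAL htL g hg
    have h1 := (isAlgebraic_closure_iff L _ g).mpr (hCg g hg L hAL)
    refine isAlgebraic_of_subfield_le ?_ h1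
    rw [Subfield.closure_le]
    rintro x (hx | hx)
    · exact hx
    · rw [Set.mem_singleton_iff] at hx
      exact hx ▸ htL
  -- `F₀`
  have hK₀F₀ : K₀ ≤ F₀ := fun x hx => hF₀ ▸ Subfield.subset_closure (Or.inl hx)
  have htF₀ : t ∈ F₀ := hF₀ ▸ Subfield.subset_closure (Or.inr (Set.mem_insert t _))
  have hsF₀ : (↑s : Set Ω) ⊆ F₀ := fun x hx =>
    hF₀ ▸ Subfield.subset_closure (Or.inr (Set.mem_insert_of_mem t hx))
  have hF₀F : F₀ ≤ F := by
    rw [hF₀, Subfield.closure_le]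
    rintro x (hx | hx)
    · exact hKF (hK₀K hx)
    · rcases Set.mem_insert_iff.mp hx with rfl | hx
      · exact htF
      · exact hsF' hx
  have hfg : FGOver K₀ F₀ := ⟨insert t s, by rw [hF₀, Finset.coe_insert]⟩
  have hsup : F₀ ⊔ K = F := by
    refine le_antisymm (sup_le hF₀F hKF) ?_
    conv_lhs => rw [← hsF]
    rw [Subfield.closure_le]
    rintro x (hx | hx)
    · exact (le_sup_right : K ≤ F₀ ⊔ K) hx
    · exact (le_sup_left : F₀ ≤ F₀ ⊔ K) (hsF₀ hx)
  have halgt : ∀ z ∈ F₀, IsAlgebraic (IntermediateField.adjoin K₀ ({t} : Set Ω)) z := by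
    set Et := IntermediateField.adjoin K₀ ({t} : Set Ω) with hEt
    have hle : F₀ ≤ (algebraicClosure Et Ω).toSubfield := by
      rw [hF₀, Subfield.closure_le]
      intro x hx
      change x ∈ (algebraicClosure Et Ω).toSubfield
      rw [IntermediateField.mem_toSubfield, mem_algebraicClosure_iff]
      rcases hx with hx | hx
      · exact isAlgebraic_algebraMap (⟨x, Et.algebraMap_mem ⟨x, hx⟩⟩ : Et)
      · rcases Set.mem_insert_iff.mp hx with rfl | hx
        · exact isAlgebraic_algebraMap
            (⟨x, IntermediateField.subset_adjoin K₀ _ (Set.mem_singleton x)⟩ : Et)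
        · exact hCg x hx K₀ hAK₀
    intro z hz
    have := hle hz
    rw [IntermediateField.mem_toSubfield, mem_algebraicClosure_iff] at this
    exact this
  have hfrF₀ : HasFiniteRank V F₀ := by
    have hAins : (↑A : Set Ω) ⊆ ↑(insert t A) := by
      rw [Finset.coe_insert]
      exact Set.subset_insert t _
    refine hasFiniteRank_of_isAlgebraic_closure V (insert t A) ((hK'K₂.trans hK₂K₀).trans hK₀F₀)
      ?_ hval fun x hx => ?_
    · rw [Finset.coe_insert]
      exact Set.insert_subset htF₀ (hAK₀.trans hK₀F₀)
    · set E₃ := Subfield.closure ((K' : Set Ω) ∪ ↑(insert t A)) with hE₃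
      have hK₂E₃ : K₂ ≤ E₃ := hK₂le _ hAins
      have htE₃ : t ∈ E₃ :=
        Subfield.subset_closure (Or.inr (by rw [Finset.coe_insert]; exact Set.mem_insert t _))
      have hAE₃ : (↑A : Set Ω) ⊆ E₃ := fun a ha => Subfield.subset_closure (Or.inr (hAins ha))
      have hle : F₀ ≤ (algebraicClosure E₃ Ω).toSubfield := by
        rw [hF₀, Subfield.closure_le]
        intro z hz
        change z ∈ (algebraicClosure E₃ Ω).toSubfield
        rw [IntermediateField.mem_toSubfield, mem_algebraicClosure_iff]
        rcases hz with hz | hz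
        · exact isAlgebraic_of_subfield_le hK₂E₃ (halgK₀ z hz)
        · rcases Set.mem_insert_iff.mp hz with rfl | hz
          · exact isAlgebraic_algebraMap (⟨z, htE₃⟩ : E₃)
          · exact hgen' E₃ hAE₃ htE₃ z hz
      have := hle hx
      rw [IntermediateField.mem_toSubfield, mem_algebraicClosure_iff] at this
      exact this
  exact ⟨hK₀K, hAK₀, hyK₀, halgK₀, hrel, hfrK₀, hK₀F₀, hF₀F, htF₀, hsF₀, hfg, halgt, hsup, hfrF₀⟩

/-- **Cor. 3.8 with the first clause of Cor. 3.16, for given finite data.** In the situation of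
`cor38_construction`, if moreover `A` contains a prescribed finite `S ⊆ K`, the subfield
`K₁ ≤ ℙ(A)` is such that `Kv` is algebraic over `K₁v(yv)` (`exists_residue_transcendence_family`),
and — when `F|K` is separably generated — `A` contains the data placing a separating
transcendence basis `T` of `F|K` inside `K'(s)` and making `t` and the generators `s` separable
over `K'(T)` for every `K' ⊇ A`, then `K₀, F₀` satisfy all conclusions of `Kuhlmann2016_Cor38`
except the cofinality clause. [cite: Kuhlmann2016, Cor. 3.8 and Cor. 3.16 (proofs)] -/
theorem cor38_of_data {K F : Subfield Ω} {t : Ω} {s S : Finset Ω}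
    (hKF : K ≤ F) (hsF : Subfield.closure ((K : Set Ω) ∪ s) = F) (htF : t ∈ F)
    {κ : Type*} {y : κ → Ω} (hyK : ∀ j, y j ∈ K) (hyV : ∀ j, y j ∈ V)
    (hri : AlgebraicIndependent (resField V ⊥) (fun j => residue V ⟨y j, hyV j⟩))
    {K₁ : Subfield Ω} {A : Finset Ω} (hK₁A : K₁ ≤ Subfield.closure (↑A : Set Ω))
    (hres : ∀ r ∈ resField V K, IsAlgebraic
      (Subfield.closure ((resField V K₁ : Set (ResidueField V)) ∪
        Set.range (fun j => (residue V ⟨y j, hyV j⟩ : ResidueField V)))) r)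
    (hAK : (↑A : Set Ω) ⊆ K) (hSA : (↑S : Set Ω) ⊆ ↑A)
    (hCg : ∀ g ∈ s, ∀ K' : Subfield Ω, (↑A : Set Ω) ⊆ K' →
      IsAlgebraic (IntermediateField.adjoin K' ({t} : Set Ω)) g)
    (hD : SeparablyGeneratedOver K F → ∃ T : Finset Ω, AlgebraicIndependent K ((↑) : T → Ω) ∧
      ∀ K' : Subfield Ω, (↑A : Set Ω) ⊆ K' →
        (↑T : Set Ω) ⊆ Subfield.closure ((K' : Set Ω) ∪ ↑s) ∧
        ∀ g ∈ insert t (↑s : Set Ω), IsSeparable (IntermediateField.adjoin K' (↑T : Set Ω)) g)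
    {K₀ F₀ : Subfield Ω}
    (hK₀ : K₀ = K ⊓ (algebraicClosure (Subfield.closure ((↑A : Set Ω) ∪ Set.range y)) Ω).toSubfield)
    (hF₀ : F₀ = Subfield.closure ((K₀ : Set Ω) ∪ insert t (↑s : Set Ω))) :
    (K₀ ≤ K ∧ (↑S : Set Ω) ⊆ K₀ ∧ (∀ a ∈ K, IsAlgebraic K₀ a → a ∈ K₀) ∧
      HasFiniteRank V K₀ ∧ IsResiduallyAlgebraicOver V K₀ K ∧
      K₀ ≤ F₀ ∧ F₀ ≤ F ∧ t ∈ F₀ ∧ FGOver K₀ F₀ ∧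
      (∀ z ∈ F₀, IsAlgebraic (IntermediateField.adjoin K₀ ({t} : Set Ω)) z) ∧ F₀ ⊔ K = F ∧
      (SeparablyGeneratedOver K F → SeparablyGeneratedOver K₀ F₀)) ∧
    ((↑A : Set Ω) ⊆ K₀ ∧ (∀ j, y j ∈ K₀) ∧ (↑s : Set Ω) ⊆ F₀ ∧ HasFiniteRank V F₀ ∧
      ∀ a ∈ K₀, IsAlgebraic (Subfield.closure ((↑A : Set Ω) ∪ Set.range y)) a) := by
  obtain ⟨hK₀K, hAK₀, hyK₀, halgK₀, hrel, hfrK₀, hK₀F₀, hF₀F, htF₀, hsF₀, hfg, halgt, hsup,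
    hfrF₀⟩ := cor38_construction V hKF hsF htF hyK hyV hri hAK hCg hK₀ hF₀
  have hclAK₀ : Subfield.closure (↑A : Set Ω) ≤ K₀ := Subfield.closure_le.mpr hAK₀
  refine ⟨⟨hK₀K, hSA.trans hAK₀, hrel, hfrK₀, ?_, hK₀F₀, hF₀F, htF₀, hfg, halgt, hsup, ?_⟩,
    hAK₀, hyK₀, hsF₀, hfrF₀, halgK₀⟩
  · exact isResiduallyAlgebraicOver_of_residue_family V (hK₁A.trans hclAK₀) hyV hyK₀ hres
  · intro hsep
    obtain ⟨T, hTind, hT⟩ := hD hsep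
    obtain ⟨hTA, hTsep⟩ := hT K₀ hAK₀
    have hTF₀ : (↑T : Set Ω) ⊆ F₀ := by
      have hle : Subfield.closure ((K₀ : Set Ω) ∪ ↑s) ≤ F₀ := by
        rw [Subfield.closure_le]
        rintro x (hx | hx)
        · exact hK₀F₀ hx
        · exact hsF₀ hx
      exact fun x hx => hle (hTA hx)
    refine ⟨T, hTF₀, algebraicIndependent_of_subfield_le hK₀K hTind, ?_⟩
    set ET := IntermediateField.adjoin K₀ (↑T : Set Ω) with hET
    have hle : F₀ ≤ (separableClosure ET Ω).toSubfield := by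
      rw [hF₀, Subfield.closure_le]
      intro x hx
      change x ∈ (separableClosure ET Ω).toSubfield
      rw [IntermediateField.mem_toSubfield, mem_separableClosure_iff]
      rcases hx with hx | hx
      · exact isSeparable_algebraMap (⟨x, ET.algebraMap_mem ⟨x, hx⟩⟩ : ET)
      · exact hTsep x hx
    intro x hx
    have := hle hx
    rw [IntermediateField.mem_toSubfield, mem_separableClosure_iff] at this
    exact this

end Construction

/-! ### Cor. 3.8 / Cor. 3.16 -/

/-- **Kuhlmann 2016, Cor. 3.8 with Cor. 3.16 (fields of definition of finite rank) — PROVED**: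
the named fact `Kuhlmann2016_Cor38` of `Kuhlmann2019HenselianRationalitySteps.lean` holds.
Following the printed proofs (pp. 10–12 of arXiv:1304.0194): `K₁ = ℙ(A)` for a finite `A ⊆ K`
containing `S` and the coefficients of the algebraic dependences of the generators of `F` over
`K(t)` ("There exists a finitely generated subfield `K₁` of `K` such that `a₁,…,aₙ` are
algebraic over `K₁(𝒯)` … This will still hold if we replace `K₁` by any extension field of
`K₁` within `K`"); a family `y` in `K` whose residues form a transcendence basis of `Kv|K₁v`
(`exists_residue_transcendence_family`); `K₀` the relative algebraic closure of `K₁(y)` in `K`,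
of finite rank by Lemma 2.2 and Kuhlmann 2010, Cor. 2.7 (`hasFiniteRank_of_isAlgebraic_closure`);
`F₀ = K₀(t, a₁, …, aₙ)`. Cor. 3.16: for `F|K` separably generated, `A` also contains the data
of a separating transcendence basis ("using the fact that the finitely generated separable
extension `F|K` is separably generated"); for `vK` cofinal in `vF`: "If `vF` admits a biggest
proper convex subgroup, then let `K₀` contain a nonzero element whose value does not lie in
this subgroup. If `vF` … does not admit a biggest proper convex subgroup, then first choose `F₀`
and `K₀` as in the … proof of Corollary 3.8; since `F₀` has finite rank, there exists some
element in `K` whose value does not lie in the convex hull of `vF₀` in `vF`, and adding this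
element to `K₀` and `F₀` will make `vK₀` cofinal in `vF₀`" (`exists_dominating_of_hasFiniteRank`,
`exists_valuation_pow_le_of_infinitesimal`, `exists_valuation_le_of_isAlgebraic`).
[cite: Kuhlmann2016, Cor. 3.8 and Cor. 3.16] -/
theorem Kuhlmann2016_Cor38_holds : Kuhlmann2016_Cor38.{u} := by
  intro Ω _ V K F t S hKF hfg htF _htt halgt hSK
  classical
  obtain ⟨s, hsF⟩ := hfg
  have hsF' : (↑s : Set Ω) ⊆ F := fun x hx => hsF ▸ Subfield.subset_closure (Or.inr hx)
  -- (a) coefficient data of the generators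
  have hgenK : ∀ g ∈ s, IsAlgebraic (IntermediateField.adjoin K ({t} : Set Ω)) g :=
    fun g hg => halgt g (hsF' hg)
  have hCg0 : ∀ g : Ω, ∃ C : Finset Ω, (↑C : Set Ω) ⊆ K ∧ (g ∈ s → ∀ K' : Subfield Ω,
      (↑C : Set Ω) ⊆ K' → IsAlgebraic (IntermediateField.adjoin K' ({t} : Set Ω)) g) := by
    intro g
    by_cases hg : g ∈ s
    · obtain ⟨C, hCK, hC⟩ := exists_finset_isAlgebraic_adjoin (hgenK g hg)
      exact ⟨C, hCK, fun _ => hC⟩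
    · exact ⟨∅, by simp, fun h => absurd h hg⟩
  choose Cg hCgK hCg using hCg0
  -- (b) separability data
  have hsepdata : ∃ D : Finset Ω, (↑D : Set Ω) ⊆ K ∧ (SeparablyGeneratedOver K F →
      ∃ T : Finset Ω, AlgebraicIndependent K ((↑) : T → Ω) ∧ ∀ K' : Subfield Ω,
        (↑D : Set Ω) ⊆ K' → (↑T : Set Ω) ⊆ Subfield.closure ((K' : Set Ω) ∪ ↑s) ∧
        ∀ g ∈ insert t (↑s : Set Ω), IsSeparable (IntermediateField.adjoin K' (↑T : Set Ω)) g) := by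
    by_cases hsep : SeparablyGeneratedOver K F
    · obtain ⟨T, hTF, hTind, hTsep⟩ := hsep
      have h1 : ∀ x : Ω, ∃ C : Finset Ω, (↑C : Set Ω) ⊆ K ∧ (x ∈ (↑T : Set Ω) →
          ∀ K' : Subfield Ω, (↑C : Set Ω) ⊆ K' → x ∈ Subfield.closure ((K' : Set Ω) ∪ ↑s)) := by
        intro x
        by_cases hx : x ∈ (↑T : Set Ω)
        · have hxF : x ∈ Subfield.closure ((K : Set Ω) ∪ ↑s) := hsF.symm ▸ hTF hx
          obtain ⟨C, hCK, hC⟩ := exists_finset_mem_adjoin hxF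
          exact ⟨C, hCK, fun _ => hC⟩
        · exact ⟨∅, by simp, fun h => absurd h hx⟩
      choose C₁ hC₁K hC₁ using h1
      have h2 : ∀ g : Ω, ∃ C : Finset Ω, (↑C : Set Ω) ⊆ K ∧ (g ∈ insert t (↑s : Set Ω) →
          ∀ K' : Subfield Ω, (↑C : Set Ω) ⊆ K' →
            IsSeparable (IntermediateField.adjoin K' (↑T : Set Ω)) g) := by
        intro g
        by_cases hg : g ∈ insert t (↑s : Set Ω)
        · have hgF : g ∈ F := by
            rcases Set.mem_insert_iff.mp hg with rfl | hg
            · exact htF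
            · exact hsF' hg
          obtain ⟨C, hCK, hC⟩ := exists_finset_isSeparable_adjoin (hTsep g hgF)
          exact ⟨C, hCK, fun _ => hC⟩
        · exact ⟨∅, by simp, fun h => absurd h hg⟩
      choose C₂ hC₂K hC₂ using h2
      refine ⟨T.biUnion C₁ ∪ (insert t s).biUnion C₂, ?_,
        fun _ => ⟨T, hTind, fun K' hK' => ⟨?_, ?_⟩⟩⟩
      · rw [Finset.coe_union, Finset.coe_biUnion, Finset.coe_biUnion]
        exact Set.union_subset (Set.iUnion₂_subset fun x _ => hC₁K x)
          (Set.iUnion₂_subset fun g _ => hC₂K g)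
      · intro x hx
        refine hC₁ x hx K' fun c hc => hK' ?_
        rw [Finset.coe_union, Finset.coe_biUnion]
        exact Or.inl (Set.mem_biUnion hx hc)
      · intro g hg
        have hg' : g ∈ (↑(insert t s) : Set Ω) := by rwa [Finset.coe_insert]
        refine hC₂ g hg K' fun c hc => hK' ?_
        rw [Finset.coe_union, Finset.coe_biUnion, Finset.coe_biUnion]
        exact Or.inr (Set.mem_biUnion hg' hc)
    · exact ⟨∅, by simp, fun h => absurd h hsep⟩
  obtain ⟨D, hDK, hD⟩ := hsepdata
  -- (c) the basic finite set `A₁` and the data along `A ⊇ A₁`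
  set A₁ : Finset Ω := S ∪ s.biUnion Cg ∪ D with hA₁
  have hA₁K : (↑A₁ : Set Ω) ⊆ K := by
    rw [hA₁, Finset.coe_union, Finset.coe_union, Finset.coe_biUnion]
    exact Set.union_subset (Set.union_subset hSK (Set.iUnion₂_subset fun g _ => hCgK g)) hDK
  have hSA₁ : (↑S : Set Ω) ⊆ ↑A₁ := by
    rw [hA₁, Finset.coe_union, Finset.coe_union]
    exact Set.subset_union_left.trans Set.subset_union_left
  have hCgA : ∀ A : Finset Ω, A₁ ⊆ A → ∀ g ∈ s, ∀ K' : Subfield Ω, (↑A : Set Ω) ⊆ K' →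
      IsAlgebraic (IntermediateField.adjoin K' ({t} : Set Ω)) g := by
    intro A hA g hg K' hK'
    refine hCg g hg K' fun c hc => hK' (hA ?_)
    rw [hA₁]
    exact Finset.mem_union_left _ (Finset.mem_union_right _ (Finset.mem_biUnion.mpr ⟨g, hg, hc⟩))
  have hDA : ∀ A : Finset Ω, A₁ ⊆ A → (SeparablyGeneratedOver K F →
      ∃ T : Finset Ω, AlgebraicIndependent K ((↑) : T → Ω) ∧ ∀ K' : Subfield Ω,
        (↑A : Set Ω) ⊆ K' → (↑T : Set Ω) ⊆ Subfield.closure ((K' : Set Ω) ∪ ↑s) ∧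
        ∀ g ∈ insert t (↑s : Set Ω), IsSeparable (IntermediateField.adjoin K' (↑T : Set Ω)) g) := by
    intro A hA hsep
    obtain ⟨T, hTind, hT⟩ := hD hsep
    refine ⟨T, hTind, fun K' hK' => hT K' fun c hc => hK' (hA ?_)⟩
    rw [hA₁]
    exact Finset.mem_union_right _ hc
  -- (d) the residue-transcendence family over `K₁ = ℙ(A₁)`
  set K₁ : Subfield Ω := Subfield.closure (↑A₁ : Set Ω) with hK₁
  have hK₁K : K₁ ≤ K := Subfield.closure_le.mpr hA₁K
  obtain ⟨κ, y, hyV, hyK, hri₁, hres⟩ := exists_residue_transcendence_family V hK₁K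
  have hri : AlgebraicIndependent (resField V ⊥) (fun j => residue V ⟨y j, hyV j⟩) :=
    algebraicIndependent_of_subfield_le (resField_mono V bot_le) hri₁
  have hK₁A : ∀ A : Finset Ω, A₁ ⊆ A → K₁ ≤ Subfield.closure (↑A : Set Ω) := fun A hA =>
    Subfield.closure_mono (Finset.coe_subset.mpr hA)
  have hSA : ∀ A : Finset Ω, A₁ ⊆ A → (↑S : Set Ω) ⊆ ↑A := fun A hA =>
    hSA₁.trans (Finset.coe_subset.mpr hA)
  -- (e) cofinality: the three cases
  by_cases hcof : IsValueCofinal V K F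
  swap
  · obtain ⟨h, -⟩ := cor38_of_data V hKF hsF htF hyK hyV hri (hK₁A A₁ subset_rfl) hres hA₁K
      (hSA A₁ subset_rfl) (hCgA A₁ subset_rfl) (hDA A₁ subset_rfl) rfl rfl
    obtain ⟨h1, h2, h3, h4, h5, h6, h7, h8, h9, h10, h11, h12⟩ := h
    exact ⟨_, _, h1, h2, h3, h4, h5, h6, h7, h8, h9, h10, h11, h12, fun h => absurd h hcof⟩
  by_cases hcase : ∃ b ∈ K, b ≠ 0 ∧ V.valuation b ≤ 1 ∧
      ∀ a ∈ F, a ≠ 0 → ∃ n : ℕ, V.valuation b ^ n ≤ V.valuation a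
  · -- Case 1: `vF` has a biggest proper convex subgroup, avoided by `v(b)`, `b ∈ K`
    obtain ⟨b, hbK, hb0, hb1, hb⟩ := hcase
    have hA : A₁ ⊆ insert b A₁ := Finset.subset_insert b A₁
    have hAK : (↑(insert b A₁) : Set Ω) ⊆ K := by
      rw [Finset.coe_insert]
      exact Set.insert_subset hbK hA₁K
    obtain ⟨h, hAK₀, -, -, -, -⟩ := cor38_of_data V hKF hsF htF hyK hyV hri (hK₁A _ hA) hres hAK
      (hSA _ hA) (hCgA _ hA) (hDA _ hA) rfl rfl
    obtain ⟨h1, h2, h3, h4, h5, h6, h7, h8, h9, h10, h11, h12⟩ := h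
    refine ⟨_, _, h1, h2, h3, h4, h5, h6, h7, h8, h9, h10, h11, h12, fun _ => ?_⟩
    have hbK₀ := hAK₀ (Finset.mem_coe.mpr (Finset.mem_insert_self b A₁))
    intro a haF₀ ha0
    obtain ⟨n, hn⟩ := hb a (h7 haF₀) ha0
    exact ⟨b ^ n, pow_mem hbK₀ n, pow_ne_zero n hb0, by rwa [map_pow]⟩
  · -- Case 2: first construction, then enlarge `A₁` by an element of infinitesimal value
    push Not at hcase
    obtain ⟨h', hAK₀', hyK₀', hsF₀', hfrF₀', -⟩ := cor38_of_data V hKF hsF htF hyK hyV hri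
      (hK₁A A₁ subset_rfl) hres hA₁K (hSA A₁ subset_rfl) (hCgA A₁ subset_rfl) (hDA A₁ subset_rfl)
      rfl rfl
    obtain ⟨-, -, -, -, -, hK₀F₀', hF₀F', htF₀', -, -, -, -⟩ := h'
    set K₀' := K ⊓ (algebraicClosure (Subfield.closure ((↑A₁ : Set Ω) ∪ Set.range y)) Ω).toSubfield
      with hK₀'def
    set F₀' := Subfield.closure ((K₀' : Set Ω) ∪ insert t (↑s : Set Ω)) with hF₀'def
    obtain ⟨a₀, ha₀F₀, ha₀0, ha₀1, hdom⟩ := exists_dominating_of_hasFiniteRank V hfrF₀'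
    obtain ⟨b₁, hb₁K, hb₁0, hb₁⟩ := hcof a₀ (hF₀F' ha₀F₀) ha₀0
    obtain ⟨a, haF, ha0, ha⟩ := hcase b₁ hb₁K hb₁0 (hb₁.trans ha₀1)
    obtain ⟨b, hbK, hb0, hb⟩ := hcof a haF ha0
    have hbinf : ∀ c ∈ F₀', c ≠ 0 → V.valuation b < V.valuation c := by
      intro c hc hc0
      obtain ⟨n, hn⟩ := hdom c hc hc0
      calc V.valuation b ≤ V.valuation a := hb
        _ < V.valuation b₁ ^ n := ha n
        _ ≤ V.valuation a₀ ^ n := pow_le_pow_left₀ zero_le hb₁ n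
        _ ≤ V.valuation c := hn
    -- second construction
    have hA : A₁ ⊆ insert b A₁ := Finset.subset_insert b A₁
    have hAK : (↑(insert b A₁) : Set Ω) ⊆ K := by
      rw [Finset.coe_insert]
      exact Set.insert_subset hbK hA₁K
    obtain ⟨h, hAK₀, -, -, -, halgK₀⟩ := cor38_of_data V hKF hsF htF hyK hyV hri (hK₁A _ hA) hres
      hAK (hSA _ hA) (hCgA _ hA) (hDA _ hA) rfl rfl
    obtain ⟨h1, h2, h3, h4, h5, h6, h7, h8, h9, h10, h11, h12⟩ := h
    refine ⟨_, _, h1, h2, h3, h4, h5, h6, h7, h8, h9, h10, h11, h12, fun _ => ?_⟩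
    have hbK₀ := hAK₀ (Finset.mem_coe.mpr (Finset.mem_insert_self b A₁))
    set K₀ := K ⊓ (algebraicClosure
      (Subfield.closure ((↑(insert b A₁) : Set Ω) ∪ Set.range y)) Ω).toSubfield with hK₀def
    set F₀ := Subfield.closure ((K₀ : Set Ω) ∪ insert t (↑s : Set Ω)) with hF₀def
    -- `F₀` is algebraic over `Eb = F₀'(b)`
    set Eb : Subfield Ω := Subfield.closure ((F₀' : Set Ω) ∪ {b}) with hEb
    have hF₀'Eb : F₀' ≤ Eb := fun x hx => Subfield.subset_closure (Or.inl hx)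
    have hbEb : b ∈ Eb := Subfield.subset_closure (Or.inr (Set.mem_singleton b))
    have hK₂Eb : Subfield.closure ((↑(insert b A₁) : Set Ω) ∪ Set.range y) ≤ Eb := by
      rw [Subfield.closure_le]
      rintro x (hx | ⟨j, rfl⟩)
      · rw [Finset.coe_insert] at hx
        rcases Set.mem_insert_iff.mp hx with rfl | hx
        · exact hbEb
        · exact hF₀'Eb (hK₀F₀' (hAK₀' hx))
      · exact hF₀'Eb (hK₀F₀' (hyK₀' j))
    have halgEb : ∀ e ∈ F₀, IsAlgebraic Eb e := by
      have hle : F₀ ≤ (algebraicClosure Eb Ω).toSubfield := by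
        rw [hF₀def, Subfield.closure_le]
        intro x hx
        change x ∈ (algebraicClosure Eb Ω).toSubfield
        rw [IntermediateField.mem_toSubfield, mem_algebraicClosure_iff]
        rcases hx with hx | hx
        · exact isAlgebraic_of_subfield_le hK₂Eb (halgK₀ x hx)
        · rcases Set.mem_insert_iff.mp hx with rfl | hx
          · exact isAlgebraic_algebraMap (⟨x, hF₀'Eb htF₀'⟩ : Eb)
          · exact isAlgebraic_algebraMap (⟨x, hF₀'Eb (hsF₀' hx)⟩ : Eb)
      intro e he
      have := hle he
      rw [IntermediateField.mem_toSubfield, mem_algebraicClosure_iff] at this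
      exact this
    intro e he he0
    obtain ⟨e', he'Eb, he'0, hle'⟩ := exists_valuation_le_of_isAlgebraic V (halgEb e he) he0
    obtain ⟨n, hn⟩ := exists_valuation_pow_le_of_infinitesimal V hb0 hbinf he'Eb he'0
    exact ⟨b ^ n, pow_mem hbK₀ n, pow_ne_zero n hb0, hn.trans hle'⟩

end Literature.AlgebraicGeometry.Resolution
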